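import Literature.AlgebraicGeometry.Resolution.SmoothOfRegularFibre
import Literature.AlgebraicGeometry.Resolution.SmoothStalksRegular
import Literature.AlgebraicGeometry.Resolution.RegularLocalRingsFlatDescent
import Literature.AlgebraicGeometry.Resolution.ResolutionCharZero
import Literature.AlgebraicGeometry.Morphisms.FlatOfComp
import Mathlib.AlgebraicGeometry.Noetherian
import HarnessLib

/-!
# Smoothness descends along a flat surjective morphism of the source (fibrewise criterion)

Layer `Literature/AlgebraicGeometry/Morphisms` (cell hodgecm-mathlib, Hecke-link brick H2 socket (Sm) «`Smooth (A/K → S)`»,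
B-plan1 (g14) 19:53:49Z: B-p09 (g10) the flatness half, B-p15 (g10) this fibrewise half; count-neutral PROOF-lane capital).

EGA IV₄ 17.7.7: for `ψ : A → Q` faithfully flat (flat surjective) and `g : Q → S` locally of finite presentation, `ψ ≫ g`
smooth implies `g` smooth. We prove the fibrewise form that the tree's inputs give directly, for `S` locally Noetherian
with perfect residue fields (automatic in characteristic `0`, e.g. over `ℂ`); flatness of `g` comes by two-out-of-three
(★ `Morphisms.Flat.of_comp_of_surjective`, Stacks 02JZ): EGA IV₄ 17.5.1 / Stacks 01V8 «flat, locally of finite presentation, with smooth fibre at `x` ⇒ smooth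
at `x`», the fibre being REGULAR because it receives a flat surjective map from the smooth — hence regular — fibre of
`ψ ≫ g` (regularity descends along flat local maps, Matsumura 23.7 (i)):

* `isRegular_of_flat_surjective'` — regularity of a locally Noetherian scheme descends along a flat surjective morphism
  (stalkwise ★ `IsRegularLocalRing.of_flat_of_isLocalHom`; restated here to keep the import cone small);
* `isRegular_fiber_of_flat_surjective_of_smooth_comp` — every fibre `g⁻¹(s)` of `g` is a regular scheme;
* **`smooth_of_flat_surjective_of_smooth_comp`** — `g` is smooth (★ `mem_smoothLocus_of_isRegularLocalRing_stalk_fiber`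
  at every point, Mathlib `Scheme.Hom.smoothLocus_eq_top_iff`); `smooth_of_flat_surjective_of_smooth_comp_of_charZero`
  — the same with the perfectness discharged by characteristic `0` of the residue fields; `…_of_hom_spec` — over a
  field `k` of characteristic `0` (★ `Resolution.charZero_residueField_of_over_field`).

Consumer: `SocketQuotientSmooth` of `AbelianSchemes/AbelianSchemeConstSubgroupQuotient` (the free finite quotient
`ψ : A → A/K` is étale-surjective, `A → S` smooth). Theorems only; no definitions, no named facts.

## References

* [Grothendieck1967] A. Grothendieck, *EGA IV₄* (Publ. Math. IHÉS 32, 1967): Prop. 17.5.1 (smoothness is fibrewise for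
  flat morphisms locally of finite presentation), Prop. 17.7.7 (descent of smoothness along faithfully flat morphisms).
* [StacksProject] The Stacks Project, Tag 01V8, Tag 00TF.
* [Matsumura1987] H. Matsumura, *Commutative Ring Theory* (1987), Thm. 23.7 (i) (p. 181).
-/

noncomputable section

open CategoryTheory CategoryTheory.Limits AlgebraicGeometry

universe u

namespace Literature.AlgebraicGeometry.Morphisms

open Literature.AlgebraicGeometry.Resolution

/-! ### §1 Regularity descends along flat surjective morphisms -/

/-- **Regularity descends along a flat surjective morphism** to a locally Noetherian scheme: every local ring of `Y`
receives a flat local map from a regular local ring of `X`, hence is regular (Matsumura 23.7 (i)).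
[cite: Matsumura1987, Thm. 23.7 (i) (p. 181)] -/
theorem isRegular_of_flat_surjective' {X Y : Scheme.{u}} (π : X ⟶ Y) [Flat π] [Surjective π]
    [IsLocallyNoetherian Y] (hX : Scheme.IsRegular X) : Scheme.IsRegular Y := by
  intro y
  obtain ⟨x, rfl⟩ := π.surjective y
  letI := (π.stalkMap x).hom.toAlgebra
  haveI : Module.Flat (Y.presheaf.stalk (π x)) (X.presheaf.stalk x) := Flat.stalkMap π x
  haveI : IsLocalHom (algebraMap (Y.presheaf.stalk (π x)) (X.presheaf.stalk x)) :=
    inferInstanceAs (IsLocalHom (π.stalkMap x).hom)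
  haveI : IsRegularLocalRing (X.presheaf.stalk x) := hX x
  exact IsRegularLocalRing.of_flat_of_isLocalHom (Y.presheaf.stalk (π x)) (X.presheaf.stalk x)

/-! ### §2 The fibres of `g` are regular -/

/-- **The fibres of `g` are regular**: for `ψ : A → Q` flat surjective with `ψ ≫ g : A → S` smooth and `g` locally of
finite type over a locally Noetherian `S`, every fibre `g⁻¹(s)` is a regular scheme — it receives the flat surjective
base change of `ψ` from the fibre `(ψ ≫ g)⁻¹(s)`, which is smooth over `κ(s)`, hence regular (Stacks 056S).
[cite: Grothendieck1967, Prop. 17.7.7] [cite: Matsumura1987, Thm. 23.7 (i) (p. 181)] -/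
theorem isRegular_fiber_of_flat_surjective_of_smooth_comp {A Q S : Scheme.{u}} (ψ : A ⟶ Q) (g : Q ⟶ S)
    [Flat ψ] [Surjective ψ] [LocallyOfFiniteType g] (hf : Smooth (ψ ≫ g)) (s : S) :
    Scheme.IsRegular (g.fiber s) := by
  -- the fibre of `ψ ≫ g` over `s`, realised as `A ×_Q g⁻¹(s)`, is smooth over `Spec κ(s)`
  have sq : IsPullback (pullback.fst ψ (g.fiberι s)) (pullback.snd ψ (g.fiberι s) ≫ g.fiberToSpecResidueField s)
      (ψ ≫ g) (S.fromSpecResidueField s) :=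
    (IsPullback.of_hasPullback ψ (g.fiberι s)).paste_vert (IsPullback.of_hasPullback g (S.fromSpecResidueField s))
  have hsm : Smooth (pullback.snd ψ (g.fiberι s) ≫ g.fiberToSpecResidueField s) :=
    MorphismProperty.IsStableUnderBaseChange.of_isPullback (P := @Smooth) sq hf
  have hP : Scheme.IsRegular (pullback ψ (g.fiberι s)) := fun x =>
    @isRegularLocalRing_stalk_of_smooth_of_field _ _ _ (pullback.snd ψ (g.fiberι s) ≫ g.fiberToSpecResidueField s)
      hsm x
  -- and it maps flat-surjectively onto `g⁻¹(s)`, which is locally Noetherian (of finite type over a field)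
  haveI : IsLocallyNoetherian (g.fiber s) :=
    inferInstanceAs (IsLocallyNoetherian (pullback g (S.fromSpecResidueField s)))
  exact isRegular_of_flat_surjective' (pullback.snd ψ (g.fiberι s)) hP

/-! ### §3 Smoothness of `g` -/

/-- **Smoothness descends along a flat surjective morphism of the source, fibrewise form** (EGA IV₄ 17.7.7 via 17.5.1):
`ψ : A → Q` flat surjective, `f = ψ ≫ g` smooth, `g : Q → S` locally of finite presentation over a locally Noetherian base
with perfect residue fields ⟹ `g` smooth (`g` is flat by two-out-of-three, ★ `Morphisms.Flat.of_comp_of_surjective`;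
every point of `Q` lies in the smooth locus, its fibre being regular).
[cite: Grothendieck1967, Prop. 17.5.1 and Prop. 17.7.7] [cite: StacksProject, Tag 01V8] -/
theorem smooth_of_flat_surjective_of_smooth_comp {A Q S : Scheme.{u}} (ψ : A ⟶ Q) (g : Q ⟶ S) (f : A ⟶ S)
    (hf : ψ ≫ g = f) [Flat ψ] [Surjective ψ] [Smooth f] [LocallyOfFinitePresentation g] [IsLocallyNoetherian S]
    (hperf : ∀ q : Q, PerfectField (S.residueField (g q))) : Smooth g := by
  subst hf
  haveI : Flat g := Flat.of_comp_of_surjective ψ g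
  rw [← Scheme.Hom.smoothLocus_eq_top_iff]
  refine top_le_iff.mp fun q _ => ?_
  haveI := hperf q
  exact mem_smoothLocus_of_isRegularLocalRing_stalk_fiber g q
    (isRegular_fiber_of_flat_surjective_of_smooth_comp ψ g inferInstance (g q) (g.asFiber q))

/-- **Characteristic-zero form** (the residue fields of `S` have characteristic `0`, e.g. `S` a `ℂ`-scheme):
`ψ : A → Q` flat surjective, `f = ψ ≫ g` smooth, `g` locally of finite presentation over a locally Noetherian `S` ⟹ `g`
smooth. [cite: Grothendieck1967, Prop. 17.7.7] [cite: StacksProject, Tag 01V8] -/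
theorem smooth_of_flat_surjective_of_smooth_comp_of_charZero {A Q S : Scheme.{u}} (ψ : A ⟶ Q) (g : Q ⟶ S)
    (f : A ⟶ S) (hf : ψ ≫ g = f) [Flat ψ] [Surjective ψ] [Smooth f] [LocallyOfFinitePresentation g]
    [IsLocallyNoetherian S] (hchar : ∀ s : S, CharZero (S.residueField s)) : Smooth g :=
  smooth_of_flat_surjective_of_smooth_comp ψ g f hf fun q => by
    haveI := hchar (g q)
    exact PerfectField.ofCharZero

/-- **Over a field of characteristic `0`** (e.g. `S` a `ℂ`-scheme): `ψ : A → Q` flat surjective, `f = ψ ≫ g` smooth, `g` locally of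
finite presentation over a locally Noetherian `k`-scheme `S` ⟹ `g` smooth.
[cite: Grothendieck1967, Prop. 17.7.7] [cite: StacksProject, Tag 01V8] -/
theorem smooth_of_flat_surjective_of_smooth_comp_of_hom_spec {k : Type u} [Field k] [CharZero k]
    {A Q S : Scheme.{u}} (ψ : A ⟶ Q) (g : Q ⟶ S) (f : A ⟶ S) (hf : ψ ≫ g = f) (h : S ⟶ Spec (.of k))
    [Flat ψ] [Surjective ψ] [Smooth f] [LocallyOfFinitePresentation g] [IsLocallyNoetherian S] : Smooth g :=
  smooth_of_flat_surjective_of_smooth_comp_of_charZero ψ g f hf (charZero_residueField_of_over_field h)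

end Literature.AlgebraicGeometry.Morphisms

end
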